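import Literature.NumberTheory.Rogawski1990.ArchimedeanTransfer
import HarnessLib

/-!
# Rescaling the orbital measures: the transfer relations (14.2.1) ∕ (4.3.1) are invariant under a COMMON positive rescaling of the two
# measure families, and admissibility under any positive (class-by-class) rescaling
(Rogawski, *Automorphic representations of unitary groups in three variables* (1990), §4.3 (4.3.1) p. 43, §4.9 p. 54, §14.2 (14.2.1) p. 232:
the orbital integrals `Φ(γ, f) = ∫_{G_γ \ G} f(g⁻¹γg) dg` are LINEAR in the quotient measure `dg ∕ dg_γ`, so every normalisation of the measures
is a choice the identities survive as long as it is made on both sides at once)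

Topic `NumberTheory/Rogawski1990`; namespaces `Literature.NumberTheory.Automorphic` (§1: families, class orbital integrals, admissibility) and
`Literature.NumberTheory.Rogawski1990` (§2: the abstract relations of ★ `LocalTransfer` §1 ∕ ★ `LocalTransferExistence` ∕ ★ `ArchimedeanTransfer` §0).  THEOREMS ONLY (no def, no instance, no
named fact, no `sorry`).  SPEC-ed1.18 §6 item 2 (F0P3a-plan (g2), «one currency», Q2): the kit's measure fields are the transfer facts' families
RESCALED place by place; this file is the invariance that transports the facts' transfer identities to the rescaled families.

THE RESCALED FAMILY NEEDS NO DEFINITION: ★ `OrbitalMeasureFamily G = ∀ c : ConjClasses G, Measure (G ⧸ G_{γ_c})` is a Π-type of measures, so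
Mathlib's pointwise instances give `κ • m` for a scalar `κ : ℝ≥0∞` (`(κ • m) c = κ • m c`, `OrbitalMeasureFamily.smul_apply`) and `κ • m` for a
class-by-class weight `κ : ConjClasses G → ℝ≥0∞` (`(κ • m) c = κ c • m c`, `OrbitalMeasureFamily.pi_smul_apply`).

* §1 `classOrbitalIntegral_smul_measure` (`Φ^{κ•m}([γ], f) = κ.toReal • Φ^m([γ], f)`, ANY `κ : ℝ≥0∞` — ★ `orbitalIntegral_smul_measure`), its
  class-by-class twin `classOrbitalIntegral_pi_smul_measure`, the `ℂ`-valued product forms; **`OrbitalMeasureFamily.IsAdmissibleOn.smul`** ∕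
  `IsAdmissible.smul` (non-zero, invariant, finite on compacts survive `κ •` for `κ ≠ 0, ⊤`) and the CLASS-BY-CLASS
  **`OrbitalMeasureFamily.IsAdmissibleOn.pi_smul`** (`κ c ≠ 0, ⊤` at the `P`-classes).
* §2 (abstract groups `A`, `B`): `stableOrbitalIntegralRel_smul` (`Φ^st` against `κ • m` is `κ.toReal · Φ^st`, ★ `mul_finsum_mem`, no finiteness
  needed) and `stableOrbitalIntegralRel_pi_smul_of_const` (a class-by-class weight CONSTANT ON THE STABLE CLASS of `γ` comes out the same way);
  **`IsInnerTransferRel.smul`** ∕ **`IsDeltaTransferRel.smul`** — (14.2.1) ∕ (4.3.1) survive a COMMON scalar `κ : ℝ≥0∞` on the two families (`iff`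
  for `κ ≠ 0, ⊤`); and the generality SPEC-ed1.18 (a) A2 ∕ REVIEW-R1-74 C2 asks for: **`IsInnerTransferRel.pi_smul`** ∕ **`IsDeltaTransferRel.pi_smul`**
  — class-by-class weights `κ_A, κ_B` that are CONSTANT ON EACH (regular) STABLE CLASS and take THE SAME VALUE on the classes matching it on the
  other group ((14.2.1): `γ′ ↔ γ`; (4.3.1): `R γ_H γ`, off which `Δ` vanishes); the ∃-forms `IsInnerTransferExistsRel.(pi_)smul`,
  `IsDeltaTransferExistsRel.(pi_)smul`.  Transfer factors (★ `TransferFactorData`, `IsNondegenerate`) carry no measure: nothing to transport.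
  Per-conjugacy-class rescaling WITHOUT the constancy is NOT claimed (the `Σ_{[γ]}` of (4.3.1) mixes the classes of one stable class).
The CM-local and archimedean dresses (★ `IsLocalInnerTransfer`, `IsLocalDeltaTransfer`, `IsArchInnerTransfer`, `IsArchDeltaTransfer`, … — all
`abbrev`s of §2's relations, so §2 applies to them verbatim) are the sequel `LocalTransferRescaleCM`.

## References
* J. D. Rogawski, *Automorphic Representations of Unitary Groups in Three Variables*, Ann. of Math. Stud. 123 (1990), §1.6 p. 6, §4.3 (4.3.1) p. 43,
  §4.9 pp. 54–55, §14.2 (14.2.1) pp. 232–233, §14.3 pp. 233–234 [Rogawski1990]; A. Deitmar, S. Echterhoff, *Principles of Harmonic Analysis*,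
  2nd ed. (2014), Thm. 1.5.3 (the invariant quotient measure is unique up to a positive scalar) [DeitmarEchterhoff2014].
-/

noncomputable section

open MeasureTheory Measure NumberField IsDedekindDomain
open scoped ENNReal NNReal

/-! ## §1 Rescaled families: class orbital integrals and admissibility -/

namespace Literature.NumberTheory.Automorphic

section SMul

variable {G : Type*} [Group G] [∀ γ : G, MeasurableSpace (G ⧸ Subgroup.centralizer ({γ} : Set G))]
  {E : Type*} [NormedAddCommGroup E] [NormedSpace ℝ E]

/-- `(κ • m) c = κ • m c` for a scalar `κ : ℝ≥0∞` (Mathlib's pointwise action on the Π-type ★ `OrbitalMeasureFamily`). [cite: Rogawski1990, §4.9 p. 54] -/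
theorem OrbitalMeasureFamily.smul_apply (κ : ℝ≥0∞) (m : OrbitalMeasureFamily G) (c : ConjClasses G) : (κ • m) c = κ • m c := rfl

/-- `(κ • m) c = κ c • m c` for a class-by-class weight `κ : ConjClasses G → ℝ≥0∞` (Mathlib's `Pi.instSMul'`). [cite: Rogawski1990, §4.9 p. 54] -/
theorem OrbitalMeasureFamily.pi_smul_apply (κ : ConjClasses G → ℝ≥0∞) (m : OrbitalMeasureFamily G) (c : ConjClasses G) :
    (κ • m) c = κ c • m c := rfl

/-- **`Φ^{κ • m}([γ], f) = κ.toReal • Φ^m([γ], f)`**, ANY `κ : ℝ≥0∞` (★ `orbitalIntegral_smul_measure` at the representative). [cite: Rogawski1990, §4.9 p. 54] -/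
theorem classOrbitalIntegral_smul_measure (κ : ℝ≥0∞) (m : OrbitalMeasureFamily G) (f : G → E) (c : ConjClasses G) :
    classOrbitalIntegral (κ • m) f c = κ.toReal • classOrbitalIntegral m f c :=
  orbitalIntegral_smul_measure _ _ κ f

/-- Class-by-class: `Φ^{κ • m}([γ], f) = (κ [γ]).toReal • Φ^m([γ], f)`. [cite: Rogawski1990, §4.9 p. 54] -/
theorem classOrbitalIntegral_pi_smul_measure (κ : ConjClasses G → ℝ≥0∞) (m : OrbitalMeasureFamily G) (f : G → E) (c : ConjClasses G) :
    classOrbitalIntegral (κ • m) f c = (κ c).toReal • classOrbitalIntegral m f c :=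
  orbitalIntegral_smul_measure _ _ (κ c) f

/-- `ℂ`-valued form: `Φ^{κ • m}([γ], f) = κ.toReal · Φ^m([γ], f)`. [cite: Rogawski1990, §4.9 p. 54] -/
theorem classOrbitalIntegral_smul_measure_eq_mul (κ : ℝ≥0∞) (m : OrbitalMeasureFamily G) (f : G → ℂ) (c : ConjClasses G) :
    classOrbitalIntegral (κ • m) f c = (κ.toReal : ℂ) * classOrbitalIntegral m f c := by
  rw [classOrbitalIntegral_smul_measure, Complex.real_smul]

/-- `ℂ`-valued class-by-class form. [cite: Rogawski1990, §4.9 p. 54] -/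
theorem classOrbitalIntegral_pi_smul_measure_eq_mul (κ : ConjClasses G → ℝ≥0∞) (m : OrbitalMeasureFamily G) (f : G → ℂ) (c : ConjClasses G) :
    classOrbitalIntegral (κ • m) f c = ((κ c).toReal : ℂ) * classOrbitalIntegral m f c := by
  rw [classOrbitalIntegral_pi_smul_measure, Complex.real_smul]

/-- `κ • m` recovers `m` after rescaling by `κ⁻¹` (`κ ≠ 0, ⊤`). [cite: Rogawski1990, §4.9 p. 54] -/
theorem OrbitalMeasureFamily.inv_smul_smul {κ : ℝ≥0∞} (h0 : κ ≠ 0) (htop : κ ≠ ⊤) (m : OrbitalMeasureFamily G) : κ⁻¹ • κ • m = m := by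
  rw [smul_smul, ENNReal.inv_mul_cancel h0 htop, one_smul]

/-- A non-zero measure stays non-zero under `κ •`, `κ ≠ 0, ⊤`. [cite: Rogawski1990, §1.6 p. 6] -/
theorem OrbitalMeasureFamily.smul_apply_ne_zero {κ : ℝ≥0∞} (h0 : κ ≠ 0) (htop : κ ≠ ⊤) {m : OrbitalMeasureFamily G} {c : ConjClasses G}
    (h : m c ≠ 0) : κ • m c ≠ 0 := fun hz =>
  h (by rw [← one_smul ℝ≥0∞ (m c), ← ENNReal.inv_mul_cancel h0 htop, mul_smul, hz, smul_zero])

variable [TopologicalSpace G]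

/-- **Admissibility on `P` survives a positive finite rescaling**: `m.IsAdmissibleOn P → (κ • m).IsAdmissibleOn P` for `κ ≠ 0, ⊤` (non-zero:
`κ⁻¹ • κ • m_c = m_c`; invariant: Mathlib `SMulInvariantMeasure.smul`; finite on compacts: Mathlib `IsFiniteMeasureOnCompacts.smul`).
[cite: Rogawski1990, §1.6 p. 6; §14.2 (14.2.1) p. 232] -/
theorem OrbitalMeasureFamily.IsAdmissibleOn.smul {P : G → Prop} {m : OrbitalMeasureFamily G} (h : m.IsAdmissibleOn P) {κ : ℝ≥0∞}
    (h0 : κ ≠ 0) (htop : κ ≠ ⊤) : (κ • m).IsAdmissibleOn P := by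
  intro c hc
  obtain ⟨hne, hinv, hfin⟩ := h c hc
  refine ⟨OrbitalMeasureFamily.smul_apply_ne_zero h0 htop hne, ?_, ?_⟩
  · show SMulInvariantMeasure G _ (κ • m c)
    infer_instance
  · show IsFiniteMeasureOnCompacts (κ • m c)
    exact IsFiniteMeasureOnCompacts.smul _ htop

/-- The `iff` form: for `κ ≠ 0, ⊤`, `(κ • m).IsAdmissibleOn P ↔ m.IsAdmissibleOn P`. [cite: Rogawski1990, §1.6 p. 6] -/
theorem OrbitalMeasureFamily.isAdmissibleOn_smul_iff {P : G → Prop} (m : OrbitalMeasureFamily G) {κ : ℝ≥0∞} (h0 : κ ≠ 0) (htop : κ ≠ ⊤) :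
    (κ • m).IsAdmissibleOn P ↔ m.IsAdmissibleOn P :=
  ⟨fun h => by simpa only [OrbitalMeasureFamily.inv_smul_smul h0 htop] using h.smul (ENNReal.inv_ne_zero.2 htop) (ENNReal.inv_ne_top.2 h0),
    fun h => h.smul h0 htop⟩

/-- Admissibility everywhere survives a positive finite rescaling. [cite: Rogawski1990, §1.6 p. 6] -/
theorem OrbitalMeasureFamily.IsAdmissible.smul {m : OrbitalMeasureFamily G} (h : m.IsAdmissible) {κ : ℝ≥0∞} (h0 : κ ≠ 0) (htop : κ ≠ ⊤) :
    (κ • m).IsAdmissible :=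
  (OrbitalMeasureFamily.isAdmissibleOn_top_iff _).1 (((OrbitalMeasureFamily.isAdmissibleOn_top_iff m).2 h).smul h0 htop)

/-- **Class-by-class rescaling preserves admissibility on `P`** as soon as the weights at the `P`-classes are `≠ 0, ⊤` — the shape of a
normalisation `κ c := (m c (π K))⁻¹` class by class. [cite: Rogawski1990, §1.6 p. 6; §14.2 (14.2.1) p. 232] -/
theorem OrbitalMeasureFamily.IsAdmissibleOn.pi_smul {P : G → Prop} {m : OrbitalMeasureFamily G} (h : m.IsAdmissibleOn P)
    {κ : ConjClasses G → ℝ≥0∞} (hκ : ∀ c : ConjClasses G, P (Quotient.out c) → κ c ≠ 0 ∧ κ c ≠ ⊤) : (κ • m).IsAdmissibleOn P := by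
  intro c hc
  obtain ⟨hne, hinv, hfin⟩ := h c hc
  obtain ⟨h0, htop⟩ := hκ c hc
  refine ⟨?_, ?_, ?_⟩
  · show κ c • m c ≠ 0
    exact OrbitalMeasureFamily.smul_apply_ne_zero h0 htop hne
  · show SMulInvariantMeasure G _ (κ c • m c)
    infer_instance
  · show IsFiniteMeasureOnCompacts (κ c • m c)
    exact IsFiniteMeasureOnCompacts.smul _ htop

/-- Class-by-class rescaling preserves admissibility everywhere (all weights `≠ 0, ⊤`). [cite: Rogawski1990, §1.6 p. 6] -/
theorem OrbitalMeasureFamily.IsAdmissible.pi_smul {m : OrbitalMeasureFamily G} (h : m.IsAdmissible) {κ : ConjClasses G → ℝ≥0∞}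
    (hκ : ∀ c : ConjClasses G, κ c ≠ 0 ∧ κ c ≠ ⊤) : (κ • m).IsAdmissible :=
  (OrbitalMeasureFamily.isAdmissibleOn_top_iff _).1
    (((OrbitalMeasureFamily.isAdmissibleOn_top_iff m).2 h).pi_smul fun c _ => hκ c)

end SMul

end Literature.NumberTheory.Automorphic

/-! ## §2 The abstract relations: `Φ^st`, (14.2.1), (4.3.1) and their ∃-forms under a common rescaling -/

namespace Literature.NumberTheory.Rogawski1990

open Literature.NumberTheory.Automorphic

section Abstract

variable {G : Type*} [Group G] [∀ γ : G, MeasurableSpace (G ⧸ Subgroup.centralizer ({γ} : Set G))]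

/-- **`Φ^st` against `κ • m` is `κ.toReal · Φ^st`** (any `κ : ℝ≥0∞`; the `finsum` over the classes in `𝒪_st(γ)` commutes with the scalar by
★ `mul_finsum_mem` — no finiteness needed over `ℂ`). [cite: Rogawski1990, §4.1 (4.1.1) p. 39] -/
theorem stableOrbitalIntegralRel_smul (st : G → G → Prop) (κ : ℝ≥0∞) (m : OrbitalMeasureFamily G) (f : G → ℂ) (γ : G) :
    stableOrbitalIntegralRel st (κ • m) f γ = (κ.toReal : ℂ) * stableOrbitalIntegralRel st m f γ := by
  rw [stableOrbitalIntegralRel_def, stableOrbitalIntegralRel_def, mul_finsum_mem]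
  exact finsum_mem_congr rfl fun c _ => classOrbitalIntegral_smul_measure_eq_mul κ m f c

/-- **A class-by-class weight constant on the stable class of `γ` comes out of `Φ^st(γ, ·)`**: if `κ c = t` for every class `c` in
`𝒪_st(γ)` then `Φ^st_{κ • m}(γ, f) = t.toReal · Φ^st_m(γ, f)` (nothing is asked of `κ` at the other classes). [cite: Rogawski1990, §4.1 (4.1.1) p. 39] -/
theorem stableOrbitalIntegralRel_pi_smul_of_const (st : G → G → Prop) {κ : ConjClasses G → ℝ≥0∞} {t : ℝ≥0∞} {γ : G}
    (hκ : ∀ c : ConjClasses G, st γ (Quotient.out c) → κ c = t) (m : OrbitalMeasureFamily G) (f : G → ℂ) :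
    stableOrbitalIntegralRel st (κ • m) f γ = (t.toReal : ℂ) * stableOrbitalIntegralRel st m f γ := by
  rw [stableOrbitalIntegralRel_def, stableOrbitalIntegralRel_def, mul_finsum_mem]
  exact finsum_mem_congr rfl fun c hc => by rw [classOrbitalIntegral_pi_smul_measure_eq_mul, hκ c hc]

variable {A B : Type*} [Group A] [Group B]
  [∀ a : A, MeasurableSpace (A ⧸ Subgroup.centralizer ({a} : Set A))]
  [∀ b : B, MeasurableSpace (B ⧸ Subgroup.centralizer ({b} : Set B))]

/-- **(14.2.1) is invariant under a common rescaling of the two families**: if `f′ → f` for `(m′, m)` then `f′ → f` for `(κ • m′, κ • m)`,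
ANY `κ : ℝ≥0∞` (both stable orbital integrals acquire the factor `κ.toReal`). [cite: Rogawski1990, §14.2 (14.2.1) p. 232] -/
theorem IsInnerTransferRel.smul {corr : B → A → Prop} {stB : B → B → Prop} {stA : A → A → Prop} {regA : A → Prop}
    {m' : OrbitalMeasureFamily B} {m : OrbitalMeasureFamily A} {f' : B → ℂ} {f : A → ℂ}
    (h : IsInnerTransferRel corr stB stA regA m' m f' f) (κ : ℝ≥0∞) : IsInnerTransferRel corr stB stA regA (κ • m') (κ • m) f' f := by
  intro γ hγ
  obtain ⟨h1, h2⟩ := h γ hγ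
  refine ⟨fun γ' hc => ?_, fun hno => ?_⟩
  · rw [stableOrbitalIntegralRel_smul, stableOrbitalIntegralRel_smul, h1 γ' hc]
  · rw [stableOrbitalIntegralRel_smul, h2 hno, mul_zero]

/-- For `κ ≠ 0, ⊤`: (14.2.1) for `(κ • m′, κ • m)` iff for `(m′, m)`. [cite: Rogawski1990, §14.2 (14.2.1) p. 232] -/
theorem isInnerTransferRel_smul_iff {corr : B → A → Prop} {stB : B → B → Prop} {stA : A → A → Prop} {regA : A → Prop}
    (m' : OrbitalMeasureFamily B) (m : OrbitalMeasureFamily A) (f' : B → ℂ) (f : A → ℂ) {κ : ℝ≥0∞} (h0 : κ ≠ 0) (htop : κ ≠ ⊤) :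
    IsInnerTransferRel corr stB stA regA (κ • m') (κ • m) f' f ↔ IsInnerTransferRel corr stB stA regA m' m f' f :=
  ⟨fun h => by
    simpa only [OrbitalMeasureFamily.inv_smul_smul h0 htop] using h.smul κ⁻¹,
    fun h => h.smul κ⟩

/-- **(14.2.1) under CLASS-BY-CLASS weights constant along the matching** (SPEC-ed1.18 (a) A2): if, for every regular `γ ∈ A`, the weight
`κ_A` is constant (`= t_γ`) on the classes of the stable class of `γ` and `κ_B` takes the same value `t_γ` on the classes of the stable class of
every `γ′ ↔ γ`, then `f′ → f` for `(m′, m)` implies `f′ → f` for `(κ_B • m′, κ_A • m)`.  A common scalar is the sub-case of constant weights;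
weights varying INSIDE a stable class are not covered (and do not preserve the relation in general). [cite: Rogawski1990, §14.2 (14.2.1) p. 232] -/
theorem IsInnerTransferRel.pi_smul {corr : B → A → Prop} {stB : B → B → Prop} {stA : A → A → Prop} {regA : A → Prop}
    {m' : OrbitalMeasureFamily B} {m : OrbitalMeasureFamily A} {f' : B → ℂ} {f : A → ℂ}
    (h : IsInnerTransferRel corr stB stA regA m' m f' f) {κB : ConjClasses B → ℝ≥0∞} {κA : ConjClasses A → ℝ≥0∞}
    (hκ : ∀ γ : A, regA γ → ∃ t : ℝ≥0∞, (∀ c : ConjClasses A, stA γ (Quotient.out c) → κA c = t) ∧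
      ∀ γ' : B, corr γ' γ → ∀ c : ConjClasses B, stB γ' (Quotient.out c) → κB c = t) :
    IsInnerTransferRel corr stB stA regA (κB • m') (κA • m) f' f := by
  intro γ hγ
  obtain ⟨t, hA, hB⟩ := hκ γ hγ
  obtain ⟨h1, h2⟩ := h γ hγ
  refine ⟨fun γ' hc => ?_, fun hno => ?_⟩
  · rw [stableOrbitalIntegralRel_pi_smul_of_const stA hA, stableOrbitalIntegralRel_pi_smul_of_const stB (hB γ' hc), h1 γ' hc]
  · rw [stableOrbitalIntegralRel_pi_smul_of_const stA hA, h2 hno, mul_zero]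

/-- **(4.3.1) is invariant under a common rescaling of the two families**: if `f → f^H` for `(mH, mG)` and the factor `Δ` then `f → f^H`
for `(κ • mH, κ • mG)` and the same `Δ`, ANY `κ : ℝ≥0∞` (`Φ^st_H` and every `Φ([γ], f)` acquire the factor `κ.toReal`; ★ `mul_finsum`).
[cite: Rogawski1990, §4.3 (4.3.1) p. 43] -/
theorem IsDeltaTransferRel.smul {R : A → B → Prop} {stA : A → A → Prop} {regA : A → Prop} {T : TransferFactorData A B R}
    {mH : OrbitalMeasureFamily A} {mG : OrbitalMeasureFamily B} {fH : A → ℂ} {f : B → ℂ}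
    (h : IsDeltaTransferRel R stA regA T mH mG fH f) (κ : ℝ≥0∞) : IsDeltaTransferRel R stA regA T (κ • mH) (κ • mG) fH f := by
  intro a ha
  rw [stableOrbitalIntegralRel_smul, h a ha, mul_finsum]
  exact finsum_congr fun c => by rw [classOrbitalIntegral_smul_measure_eq_mul]; ring

/-- For `κ ≠ 0, ⊤`: (4.3.1) for `(κ • mH, κ • mG)` iff for `(mH, mG)`. [cite: Rogawski1990, §4.3 (4.3.1) p. 43] -/
theorem isDeltaTransferRel_smul_iff {R : A → B → Prop} {stA : A → A → Prop} {regA : A → Prop} (T : TransferFactorData A B R)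
    (mH : OrbitalMeasureFamily A) (mG : OrbitalMeasureFamily B) (fH : A → ℂ) (f : B → ℂ) {κ : ℝ≥0∞} (h0 : κ ≠ 0) (htop : κ ≠ ⊤) :
    IsDeltaTransferRel R stA regA T (κ • mH) (κ • mG) fH f ↔ IsDeltaTransferRel R stA regA T mH mG fH f :=
  ⟨fun h => by
    simpa only [OrbitalMeasureFamily.inv_smul_smul h0 htop] using h.smul κ⁻¹,
    fun h => h.smul κ⟩

/-- **(4.3.1) under CLASS-BY-CLASS weights constant along the matching** (SPEC-ed1.18 (a) A2): if, for every `G`-regular `γ_H`, the weight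
`κ_H` is constant (`= t`) on the classes of the stable class of `γ_H` and `κ_G c = t` for every class `c` MATCHING `γ_H` (`R γ_H (out c)`; off
these `Δ(γ_H, ·)` vanishes, ★ `TransferFactorData.eq_zero_of_not_rel`), then `f → f^H` for `(m^H, m^G)` implies `f → f^H` for
`(κ_H • m^H, κ_G • m^G)` with the same `Δ`. [cite: Rogawski1990, §4.3 (4.3.1) p. 43] -/
theorem IsDeltaTransferRel.pi_smul {R : A → B → Prop} {stA : A → A → Prop} {regA : A → Prop} {T : TransferFactorData A B R}
    {mH : OrbitalMeasureFamily A} {mG : OrbitalMeasureFamily B} {fH : A → ℂ} {f : B → ℂ}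
    (h : IsDeltaTransferRel R stA regA T mH mG fH f) {κH : ConjClasses A → ℝ≥0∞} {κG : ConjClasses B → ℝ≥0∞}
    (hκ : ∀ a : A, regA a → ∃ t : ℝ≥0∞, (∀ c : ConjClasses A, stA a (Quotient.out c) → κH c = t) ∧
      ∀ c : ConjClasses B, R a (Quotient.out c) → κG c = t) :
    IsDeltaTransferRel R stA regA T (κH • mH) (κG • mG) fH f := by
  intro a ha
  obtain ⟨t, hH, hG⟩ := hκ a ha
  rw [stableOrbitalIntegralRel_pi_smul_of_const stA hH, h a ha, mul_finsum]
  refine finsum_congr fun c => ?_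
  rw [classOrbitalIntegral_pi_smul_measure_eq_mul]
  by_cases hc : R a (Quotient.out c)
  · rw [hG c hc]
    ring
  · rw [T.eq_zero_of_not_rel a _ hc]
    ring

/-- The ∃-form of (14.2.1) (★ `IsInnerTransferExistsRel`) is invariant under a common rescaling (same partner `f`). [cite: Rogawski1990, §14.2 p. 233] -/
theorem IsInnerTransferExistsRel.smul {corr : B → A → Prop} {stB : B → B → Prop} {stA : A → A → Prop} {regA : A → Prop}
    {m' : OrbitalMeasureFamily B} {m : OrbitalMeasureFamily A} {SmoothB : (B → ℂ) → Prop} {SmoothA : (A → ℂ) → Prop}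
    (h : IsInnerTransferExistsRel corr stB stA regA m' m SmoothB SmoothA) (κ : ℝ≥0∞) :
    IsInnerTransferExistsRel corr stB stA regA (κ • m') (κ • m) SmoothB SmoothA := fun f' hf' => by
  obtain ⟨f, hf, hT⟩ := h f' hf'
  exact ⟨f, hf, hT.smul κ⟩

/-- The ∃-form of (4.3.1) (★ `IsDeltaTransferExistsRel`) is invariant under a common rescaling (same `f^H`). [cite: Rogawski1990, §4.9 Prop. 4.9.1 (a) p. 55] -/
theorem IsDeltaTransferExistsRel.smul {R : A → B → Prop} {stA : A → A → Prop} {regA : A → Prop} {T : TransferFactorData A B R}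
    {mH : OrbitalMeasureFamily A} {mG : OrbitalMeasureFamily B} {SmoothG : (B → ℂ) → Prop} {SmoothH : (A → ℂ) → Prop}
    (h : IsDeltaTransferExistsRel R stA regA T mH mG SmoothG SmoothH) (κ : ℝ≥0∞) :
    IsDeltaTransferExistsRel R stA regA T (κ • mH) (κ • mG) SmoothG SmoothH := fun f hf => by
  obtain ⟨fH, hfH, hT⟩ := h f hf
  exact ⟨fH, hfH, hT.smul κ⟩

/-- The ∃-form of (14.2.1) under class-by-class weights constant along the matching. [cite: Rogawski1990, §14.2 p. 233] -/
theorem IsInnerTransferExistsRel.pi_smul {corr : B → A → Prop} {stB : B → B → Prop} {stA : A → A → Prop} {regA : A → Prop}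
    {m' : OrbitalMeasureFamily B} {m : OrbitalMeasureFamily A} {SmoothB : (B → ℂ) → Prop} {SmoothA : (A → ℂ) → Prop}
    (h : IsInnerTransferExistsRel corr stB stA regA m' m SmoothB SmoothA) {κB : ConjClasses B → ℝ≥0∞} {κA : ConjClasses A → ℝ≥0∞}
    (hκ : ∀ γ : A, regA γ → ∃ t : ℝ≥0∞, (∀ c : ConjClasses A, stA γ (Quotient.out c) → κA c = t) ∧
      ∀ γ' : B, corr γ' γ → ∀ c : ConjClasses B, stB γ' (Quotient.out c) → κB c = t) :
    IsInnerTransferExistsRel corr stB stA regA (κB • m') (κA • m) SmoothB SmoothA := fun f' hf' => by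
  obtain ⟨f, hf, hT⟩ := h f' hf'
  exact ⟨f, hf, hT.pi_smul hκ⟩

/-- The ∃-form of (4.3.1) under class-by-class weights constant along the matching. [cite: Rogawski1990, §4.9 Prop. 4.9.1 (a) p. 55] -/
theorem IsDeltaTransferExistsRel.pi_smul {R : A → B → Prop} {stA : A → A → Prop} {regA : A → Prop} {T : TransferFactorData A B R}
    {mH : OrbitalMeasureFamily A} {mG : OrbitalMeasureFamily B} {SmoothG : (B → ℂ) → Prop} {SmoothH : (A → ℂ) → Prop}
    (h : IsDeltaTransferExistsRel R stA regA T mH mG SmoothG SmoothH) {κH : ConjClasses A → ℝ≥0∞} {κG : ConjClasses B → ℝ≥0∞}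
    (hκ : ∀ a : A, regA a → ∃ t : ℝ≥0∞, (∀ c : ConjClasses A, stA a (Quotient.out c) → κH c = t) ∧
      ∀ c : ConjClasses B, R a (Quotient.out c) → κG c = t) :
    IsDeltaTransferExistsRel R stA regA T (κH • mH) (κG • mG) SmoothG SmoothH := fun f hf => by
  obtain ⟨fH, hfH, hT⟩ := h f hf
  exact ⟨fH, hfH, hT.pi_smul hκ⟩

end Abstract

end Literature.NumberTheory.Rogawski1990

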